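import Literature.Topology.FourManifolds.HandleAttachingMaps
import Literature.Topology.FourManifolds.ClosedBallProofs
import Literature.Topology.FourManifolds.PalaisBallComplement
import Literature.Topology.FourManifolds.SmoothEmbeddingComp
import HarnessLib

/-!
# Transport of handle attaching maps and of handle attachments along diffeomorphisms

Topic `Literature/Topology/FourManifolds`; a proofs-and-plumbing file below
`HandleAttachingMaps.lean` (Kosinski's attaching maps `h̄ : T → M` of `λ`-handles,
`HandleAttachingMap n k M`, and the relational attachments `HandleAttachingMap.IsAttachment`,
`HandleAttachingMap.IsMultiAttachment`).  It records the first, formal, step of the proof of the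
isotopy invariance of handle attachment (Kosinski, *Differential Manifolds* (1993), VI §6 with
VIII, proof of (1.2): *"Since `Σ₂` is isotopic to `S`, `W₂` can be obtained by attaching a handle
along `S` instead"*; the tree's named fact
`Literature.Geometry.Symplectic.HandleAttachingMap.isMultiAttachment_of_linkIsotopyInBoundary`,
`Geometry/Symplectic/TwoHandleIsotopy.lean`): once the isotopy of the attaching spheres has been
extended to an ambient diffeotopy `G_t` of `M` (isotopy extension in `∂M` spread over a collar,
Kosinski II (5.2), proofs of VI (7.1)–(7.2)), the attaching maps `h̄ᵢ` are replaced by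
`G₁ ∘ h̄ᵢ`, and **a manifold `P` which is `M` with handles attached along the `h̄ᵢ` is also `M`
with handles attached along the `G₁ ∘ h̄ᵢ`** — precompose the embedding of `M ∖ ⋃ h̄ᵢ(S)` with
`G₁⁻¹` and keep the handles.  Everything here is proved:

* `HandleAttachingMap.transport h G` — the attaching map `G ∘ h̄` obtained from `h̄ : T → M` and a
  diffeomorphism `G : M ≅ M'` (a `C^∞` embedding with open range sending `T ∩ ∂Dᵐ` into `∂M'`:
  diffeomorphisms preserve boundary points, Mathlib's `Diffeomorph.image_boundary`); its core,
  range, complement and gluing relation (`core_transport`, `glueRel_transport_iff`, …), and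
  functoriality (`transport_refl`, `transport_trans`, `transport_symm_transport`);
* `HandleAttachingMap.IsMultiAttachment.transport` — **transport of simultaneous attachments**:
  `IsMultiAttachment h IP P → IsMultiAttachment (fun i => (h i).transport G) IP P`, and the
  one-handle form `HandleAttachingMap.IsAttachment.transport`;
* in dimension `4`, index `2`: `attachingCircle_transport` (`G ∘ K`) and
  `attachingFraming_transport` — the handle framing of `G ∘ h̄` is the push-forward
  `dG (ν)` of the handle framing `ν` of `h̄` (chain rule).

## References

* A. A. Kosinski, *Differential Manifolds*, Academic Press (1993), VI §6; VIII, proof of (1.2).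
  [Kosinski1993]
* R. C. Kirby, *The Topology of 4-Manifolds*, LNM 1374 (1989), Ch. I §1 ("the `h_t` move through
  Morse functions, which correspond to isotopy of the attaching maps"). [Kirby1989]
-/

open scoped Manifold ContDiff Topology
open Set Function Metric

noncomputable section

namespace Literature.Topology.FourManifolds

universe u v w

/-- Local notation: `𝔼 n` is the model Euclidean space `EuclideanSpace ℝ (Fin n)`. -/
local notation "𝔼 " n:arg => EuclideanSpace ℝ (Fin n)

/-- Local notation: `𝕊 n` is the unit sphere in `EuclideanSpace ℝ (Fin (n + 1))`. -/
local notation "𝕊 " n:arg => (Metric.sphere (0 : EuclideanSpace ℝ (Fin (n + 1))) 1)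

/-- Local notation: `𝔻 n` is the closed unit ball in `EuclideanSpace ℝ (Fin n)`. -/
local notation "𝔻 " n:arg => (Metric.closedBall (0 : EuclideanSpace ℝ (Fin n)) 1)

namespace HandleAttachingMap

section Transport

variable {n k : ℕ} {M : Type u} [TopologicalSpace M] [ChartedSpace (EuclideanHalfSpace (n + 1)) M]
  [IsManifold (𝓡∂ (n + 1)) ∞ M]
  {M' : Type v} [TopologicalSpace M'] [ChartedSpace (EuclideanHalfSpace (n + 1)) M']
  [IsManifold (𝓡∂ (n + 1)) ∞ M']
  {M'' : Type w} [TopologicalSpace M''] [ChartedSpace (EuclideanHalfSpace (n + 1)) M'']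
  [IsManifold (𝓡∂ (n + 1)) ∞ M'']

omit [IsManifold (𝓡∂ (n + 1)) ∞ M] [IsManifold (𝓡∂ (n + 1)) ∞ M'] in
/-- Two attaching maps with the same underlying map `T → M` are equal. [folklore] -/
@[ext] theorem ext {h h' : HandleAttachingMap n k M} (e : h.toFun = h'.toFun) : h = h' := by
  cases h; cases h'; cases e; rfl

/-- **Transport of an attaching map along a diffeomorphism**: for Kosinski's `h̄ : T → M` and a
diffeomorphism `G : M ≅ M'` of manifolds with boundary, `G ∘ h̄ : T → M'` is again an attaching
map — a `C^∞` embedding (`Manifold.IsSmoothEmbedding.diffeomorph_comp`) with open range, sending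
`T ∩ ∂Dᵐ` into `∂M'` because diffeomorphisms preserve boundary points
(`Diffeomorph.image_boundary`).  With `G = G₁` the end of an ambient diffeotopy this is the
attaching map "along the isotoped sphere" of Kosinski VIII, proof of (1.2).
[cite: Kosinski1993, VI §6 and VIII proof of (1.2)] -/
def transport (h : HandleAttachingMap n k M) (G : M ≃ₘ⟮𝓡∂ (n + 1), 𝓡∂ (n + 1)⟯ M') :
    HandleAttachingMap n k M' where
  toFun := G ∘ h.toFun
  isSmoothEmbedding := h.isSmoothEmbedding.diffeomorph_comp G
  isOpen_range := by
    rw [range_comp]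
    exact G.toHomeomorph.isOpenMap _ h.isOpen_range
  isBoundaryPoint y hy := by
    have hb : h.toFun y ∈ (𝓡∂ (n + 1)).boundary M := h.isBoundaryPoint y hy
    have himg : G (h.toFun y) ∈ G '' (𝓡∂ (n + 1)).boundary M := mem_image_of_mem _ hb
    rw [Diffeomorph.image_boundary (by simp) G] at himg
    exact himg

/-- The underlying map of the transported attaching map is `G ∘ h̄`. [folklore] -/
@[simp] theorem transport_toFun (h : HandleAttachingMap n k M)
    (G : M ≃ₘ⟮𝓡∂ (n + 1), 𝓡∂ (n + 1)⟯ M') : (h.transport G).toFun = G ∘ h.toFun := rfl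

/-- Pointwise form of `transport_toFun`. [folklore] -/
theorem transport_apply (h : HandleAttachingMap n k M)
    (G : M ≃ₘ⟮𝓡∂ (n + 1), 𝓡∂ (n + 1)⟯ M') (y : ↥(handleTube n k)) :
    (h.transport G).toFun y = G (h.toFun y) := rfl

/-- Transport along the identity does nothing. [folklore] -/
@[simp] theorem transport_refl (h : HandleAttachingMap n k M) :
    h.transport (Diffeomorph.refl (𝓡∂ (n + 1)) M ∞) = h :=
  ext rfl

/-- Transport is functorial: `(G' ∘ G) ∘ h̄ = G' ∘ (G ∘ h̄)`. [folklore] -/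
theorem transport_trans (h : HandleAttachingMap n k M) (G : M ≃ₘ⟮𝓡∂ (n + 1), 𝓡∂ (n + 1)⟯ M')
    (G' : M' ≃ₘ⟮𝓡∂ (n + 1), 𝓡∂ (n + 1)⟯ M'') :
    h.transport (G.trans G') = (h.transport G).transport G' :=
  ext rfl

/-- Transporting back along the inverse diffeomorphism recovers the attaching map. [folklore] -/
@[simp] theorem transport_symm_transport (h : HandleAttachingMap n k M)
    (G : M ≃ₘ⟮𝓡∂ (n + 1), 𝓡∂ (n + 1)⟯ M') : (h.transport G).transport G.symm = h :=
  ext (funext fun y => G.symm_apply_apply (h.toFun y))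

/-- … and conversely. [folklore] -/
@[simp] theorem transport_transport_symm (h : HandleAttachingMap n k M')
    (G : M ≃ₘ⟮𝓡∂ (n + 1), 𝓡∂ (n + 1)⟯ M') : (h.transport G.symm).transport G = h :=
  ext (funext fun y => G.apply_symm_apply (h.toFun y))

/-- The range of `G ∘ h̄` is the image of the range of `h̄`. [folklore] -/
theorem range_transport (h : HandleAttachingMap n k M) (G : M ≃ₘ⟮𝓡∂ (n + 1), 𝓡∂ (n + 1)⟯ M') :
    range (h.transport G).toFun = G '' range h.toFun := by
  rw [transport_toFun, range_comp]

/-- The attaching sphere of `G ∘ h̄` is the image of that of `h̄`. [folklore] -/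
theorem core_transport (h : HandleAttachingMap n k M) (G : M ≃ₘ⟮𝓡∂ (n + 1), 𝓡∂ (n + 1)⟯ M') :
    (h.transport G).core = G '' h.core := by
  rw [core, core, transport_toFun, image_comp]

/-- Membership in the attaching sphere of `G ∘ h̄`. [folklore] -/
theorem mem_core_transport_iff (h : HandleAttachingMap n k M)
    (G : M ≃ₘ⟮𝓡∂ (n + 1), 𝓡∂ (n + 1)⟯ M') {a' : M'} :
    a' ∈ (h.transport G).core ↔ G.symm a' ∈ h.core := by
  rw [core_transport]
  constructor
  · rintro ⟨a, ha, rfl⟩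
    rwa [Diffeomorph.symm_apply_apply]
  · intro ha
    exact ⟨G.symm a', ha, G.apply_symm_apply a'⟩

/-- **The gluing relation of `G ∘ h̄`** is that of `h̄` read through `G⁻¹` on the `M` side:
`(G ∘ h̄).glueRel a' b ↔ h̄.glueRel (G⁻¹ a') b`. [folklore] -/
theorem glueRel_transport_iff (h : HandleAttachingMap n k M)
    (G : M ≃ₘ⟮𝓡∂ (n + 1), 𝓡∂ (n + 1)⟯ M') {a' : M'} {b : 𝔻 (n + 1)} :
    (h.transport G).glueRel a' b ↔ h.glueRel (G.symm a') b := by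
  simp only [glueRel, transport_apply]
  constructor
  · rintro ⟨y, h1, h2, h3⟩
    exact ⟨y, h1, h2, by rw [h3, Diffeomorph.symm_apply_apply]⟩
  · rintro ⟨y, h1, h2, h3⟩
    exact ⟨y, h1, h2, by rw [← h3, Diffeomorph.apply_symm_apply]⟩

/-- Transported families with pairwise disjoint ranges stay pairwise disjoint. [folklore] -/
theorem pairwise_disjoint_range_transport {ι : Type*} {h : ι → HandleAttachingMap n k M}
    (hd : Pairwise fun i j => Disjoint (range (h i).toFun) (range (h j).toFun))
    (G : M ≃ₘ⟮𝓡∂ (n + 1), 𝓡∂ (n + 1)⟯ M') :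
    Pairwise fun i j => Disjoint (range ((h i).transport G).toFun)
      (range ((h j).transport G).toFun) := fun i j hij => by
  change Disjoint (range ((h i).transport G).toFun) (range ((h j).transport G).toFun)
  rw [range_transport, range_transport]
  exact (Set.disjoint_image_iff G.injective).2 (hd hij)

variable [T2Space M] [T2Space M']

/-- Membership in the complement `M' ∖ ⋃ᵢ (G ∘ h̄ᵢ)(S)` of the transported cores. [folklore] -/
theorem mem_coresComplement_transport_iff {ι : Type*} [Finite ι] (h : ι → HandleAttachingMap n k M)
    (G : M ≃ₘ⟮𝓡∂ (n + 1), 𝓡∂ (n + 1)⟯ M') {a' : M'} :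
    a' ∈ coresComplement (fun i => (h i).transport G) ↔ G.symm a' ∈ coresComplement h := by
  simp only [mem_coresComplement, mem_core_transport_iff]

/-- The diffeomorphism `G⁻¹ : M' ∖ ⋃ (G ∘ h̄ᵢ)(S) ≅ M ∖ ⋃ h̄ᵢ(S)` between the complements of the
cores (restriction of `G.symm`, the tree's `opensCongr`). [folklore] -/
def coresComplementCongr {ι : Type*} [Finite ι] (h : ι → HandleAttachingMap n k M)
    (G : M ≃ₘ⟮𝓡∂ (n + 1), 𝓡∂ (n + 1)⟯ M') :
    ↥(coresComplement fun i => (h i).transport G) ≃ₘ⟮𝓡∂ (n + 1), 𝓡∂ (n + 1)⟯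
      ↥(coresComplement h) :=
  opensCongr G.symm (coresComplement fun i => (h i).transport G) (coresComplement h)
    fun _ => mem_coresComplement_transport_iff h G

/-- `coresComplementCongr` acts as `G⁻¹`. [folklore] -/
@[simp] theorem coe_coresComplementCongr {ι : Type*} [Finite ι] (h : ι → HandleAttachingMap n k M)
    (G : M ≃ₘ⟮𝓡∂ (n + 1), 𝓡∂ (n + 1)⟯ M') (a' : ↥(coresComplement fun i => (h i).transport G)) :
    ((coresComplementCongr h G a' : ↥(coresComplement h)) : M) = G.symm a' := rfl

/-- **Transport of simultaneous handle attachments along a diffeomorphism** (Kosinski 1993,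
VI §6 with VIII, proof of (1.2); Kirby 1989, Ch. I §1).  If `P` is `M` with handles attached
along the attaching maps `h̄ᵢ` (`HandleAttachingMap.IsMultiAttachment h IP P`) and `G : M ≅ M'`
is a diffeomorphism, then `P` is `M'` with handles attached along the `G ∘ h̄ᵢ`: the embedding of
`M' ∖ ⋃ (G ∘ h̄ᵢ)(S)` is `jA ∘ G⁻¹`, the handles `jBᵢ` are kept, and `jA (G⁻¹ a') = jBᵢ b` holds
exactly when `h̄ᵢ.glueRel (G⁻¹ a') b`, i.e. `(G ∘ h̄ᵢ).glueRel a' b`.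
[cite: Kosinski1993, VI §6 and VIII proof of (1.2)] -/
theorem IsMultiAttachment.transport {ι : Type*} [Finite ι] {h : ι → HandleAttachingMap n k M}
    {EP HP : Type*} [NormedAddCommGroup EP] [NormedSpace ℝ EP] [TopologicalSpace HP]
    {IP : ModelWithCorners ℝ EP HP} {P : Type*} [TopologicalSpace P] [ChartedSpace HP P]
    (hP : IsMultiAttachment h IP P) (G : M ≃ₘ⟮𝓡∂ (n + 1), 𝓡∂ (n + 1)⟯ M') :
    IsMultiAttachment (fun i => (h i).transport G) IP P := by
  obtain ⟨hdisj, jA, jB, hjA, hjAo, hjB, hcov, hglue, hdisjB⟩ := hP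
  set Ψ := coresComplementCongr h G with hΨ
  refine ⟨pairwise_disjoint_range_transport hdisj G, jA ∘ Ψ, jB, ?_, ?_, hjB, ?_, ?_, hdisjB⟩
  · -- `jA ∘ G⁻¹` is a smooth embedding: precompose with the globally defined partial
    -- diffeomorphism underlying `Ψ`
    have h1 := hjA.comp_openPartialHomeomorph Ψ.toHomeomorph.toOpenPartialHomeomorph rfl
      (Ψ.contMDiff.contMDiffOn.congr fun x _ => rfl)
      (Ψ.symm.contMDiff.contMDiffOn.congr fun x _ => rfl)
    exact h1
  · have : range (jA ∘ Ψ) = range jA := Ψ.surjective.range_comp jA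
    rw [this]; exact hjAo
  · have : range (jA ∘ Ψ) = range jA := Ψ.surjective.range_comp jA
    rw [this]; exact hcov
  · intro i a' b
    rw [glueRel_transport_iff]
    exact hglue i (Ψ a') b

/-- **Transport of a single handle attachment along a diffeomorphism**: if `P` is `M ∪ H^λ`
attached along `h̄` then `P` is `M' ∪ H^λ` attached along `G ∘ h̄`.
[cite: Kosinski1993, VI §6 and VIII proof of (1.2)] -/
theorem IsAttachment.transport {h : HandleAttachingMap n k M}
    {EP HP : Type*} [NormedAddCommGroup EP] [NormedSpace ℝ EP] [TopologicalSpace HP]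
    {IP : ModelWithCorners ℝ EP HP} {P : Type*} [TopologicalSpace P] [ChartedSpace HP P]
    (hP : h.IsAttachment IP P) (G : M ≃ₘ⟮𝓡∂ (n + 1), 𝓡∂ (n + 1)⟯ M') :
    (h.transport G).IsAttachment IP P := by
  obtain ⟨jA, jB, hjA, hjAo, hjB, hjBo, hcov, hglue⟩ := hP
  -- the complement of the transported core is `G '' complement`
  have hmem : ∀ a', a' ∈ (h.transport G).complement ↔ G.symm a' ∈ h.complement := fun a' => by
    rw [mem_complement, mem_complement, mem_core_transport_iff]
  set Ψ : ↥(h.transport G).complement ≃ₘ⟮𝓡∂ (n + 1), 𝓡∂ (n + 1)⟯ ↥h.complement :=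
    opensCongr G.symm _ _ hmem with hΨ
  refine ⟨jA ∘ Ψ, jB, ?_, ?_, hjB, hjBo, ?_, ?_⟩
  · exact hjA.comp_openPartialHomeomorph Ψ.toHomeomorph.toOpenPartialHomeomorph rfl
      (Ψ.contMDiff.contMDiffOn.congr fun x _ => rfl)
      (Ψ.symm.contMDiff.contMDiffOn.congr fun x _ => rfl)
  · have : range (jA ∘ Ψ) = range jA := Ψ.surjective.range_comp jA
    rw [this]; exact hjAo
  · have : range (jA ∘ Ψ) = range jA := Ψ.surjective.range_comp jA
    rw [this]; exact hcov
  · intro a' b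
    show jA (Ψ a') = jB b ↔ (h.transport G).glueRel (a' : M') (b : 𝔻 (n + 1))
    rw [glueRel_transport_iff]
    exact hglue (Ψ a') b

/-- The converse transport: attachments along `G ∘ h̄ᵢ` are attachments along `h̄ᵢ`
(transport back along `G⁻¹`). [folklore] -/
theorem IsMultiAttachment.of_transport {ι : Type*} [Finite ι] {h : ι → HandleAttachingMap n k M}
    {EP HP : Type*} [NormedAddCommGroup EP] [NormedSpace ℝ EP] [TopologicalSpace HP]
    {IP : ModelWithCorners ℝ EP HP} {P : Type*} [TopologicalSpace P] [ChartedSpace HP P]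
    (G : M ≃ₘ⟮𝓡∂ (n + 1), 𝓡∂ (n + 1)⟯ M')
    (hP : IsMultiAttachment (fun i => (h i).transport G) IP P) : IsMultiAttachment h IP P := by
  have := hP.transport G.symm
  simpa only [transport_symm_transport] using this

/-- Transport is an equivalence on attachments. [folklore] -/
theorem isMultiAttachment_transport_iff {ι : Type*} [Finite ι] {h : ι → HandleAttachingMap n k M}
    {EP HP : Type*} [NormedAddCommGroup EP] [NormedSpace ℝ EP] [TopologicalSpace HP]
    {IP : ModelWithCorners ℝ EP HP} {P : Type*} [TopologicalSpace P] [ChartedSpace HP P]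
    (G : M ≃ₘ⟮𝓡∂ (n + 1), 𝓡∂ (n + 1)⟯ M') :
    IsMultiAttachment (fun i => (h i).transport G) IP P ↔ IsMultiAttachment h IP P :=
  ⟨IsMultiAttachment.of_transport G, fun hP => hP.transport G⟩

end Transport

/-! ### Dimension four, index two: the attaching circle and the handle framing of `G ∘ h̄` -/

section FourDim

variable {M : Type u} [TopologicalSpace M] [ChartedSpace (EuclideanHalfSpace 4) M]
  [IsManifold (𝓡∂ 4) ∞ M]
  {M' : Type v} [TopologicalSpace M'] [ChartedSpace (EuclideanHalfSpace 4) M']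
  [IsManifold (𝓡∂ 4) ∞ M']

/-- **The attaching circle of `G ∘ h̄` is `G ∘ K`.** [folklore] -/
@[simp] theorem attachingCircle_transport (h : HandleAttachingMap 3 2 M)
    (G : M ≃ₘ⟮𝓡∂ 4, 𝓡∂ 4⟯ M') : (h.transport G).attachingCircle = G ∘ h.attachingCircle := rfl

/-- Pointwise form of `attachingCircle_transport`. [folklore] -/
theorem attachingCircle_transport_apply (h : HandleAttachingMap 3 2 M)
    (G : M ≃ₘ⟮𝓡∂ 4, 𝓡∂ 4⟯ M') (θ : 𝕊 1) :
    (h.transport G).attachingCircle θ = G (h.attachingCircle θ) := rfl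

/-- **The handle framing of `G ∘ h̄` is the push-forward `dG(ν)` of the handle framing `ν` of
`h̄`** (chain rule for `d(G ∘ h̄)` at the points `(θ, 0)` of the model circle).
[cite: Kirby1989, Ch. I §2] -/
theorem attachingFraming_transport (h : HandleAttachingMap 3 2 M) (G : M ≃ₘ⟮𝓡∂ 4, 𝓡∂ 4⟯ M')
    (θ : 𝕊 1) :
    (h.transport G).attachingFraming θ =
      mfderiv (𝓡∂ 4) (𝓡∂ 4) G (h.attachingCircle θ) (h.attachingFraming θ) := by
  have hh : MDifferentiableAt (𝓡∂ 4) (𝓡∂ 4) h.toFun (coreTubePt θ) :=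
    (h.isSmoothEmbedding.contMDiff (coreTubePt θ)).mdifferentiableAt (by simp)
  have hG : MDifferentiableAt (𝓡∂ 4) (𝓡∂ 4) G (h.toFun (coreTubePt θ)) :=
    (G.contMDiff (h.toFun (coreTubePt θ))).mdifferentiableAt (by simp)
  unfold attachingFraming
  rw [transport_toFun, mfderiv_comp (coreTubePt θ) hG hh]
  rfl

end FourDim

end HandleAttachingMap

end Literature.Topology.FourManifolds

end
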